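import Mathlib
import Summits.ValiantsHypothesis.ValiantsHypothesis.Theses.PrincipalMinorColouring
import Literature.Computability.AlgebraicComplexity.ReadKDeterminantalRepresentationsProofs
import Summits.ValiantsHypothesis.ValiantsHypothesis.Theorems.PrincipalMinorColouringRankTwoImpossibleGlue

/-!
# `RankTwoImpossible` (item stmt-ValiantsHypothesis-3782, route PrincipalMinorColouring)

For large `n`, `per_n(x + J)` has no principal-minor representation
`n! · det(I_R + diag(x ∘ κ) · K)` with all colour classes `κ⁻¹(e)` of size `≤ 2`
(equivalently: `per_n` has no determinantal expression with all coefficient matrices of rank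
`≤ 2`, the `k = 2` case of the read-`k` and rank-`k` questions of Aravind–Joglekar 2015, §5).

Proof: the **dictionary** from principal-minor representations to read-`k` symbolic
determinantal representations (`exists_isSymbDetRepr_isReadK_of_pmRepr`, any class bound `r`),
followed by **Hrubeš–Joglekar 2025, Cor. 8** (read-`k` representations of `per_n` need
`k ≥ Ω(√n / log n)`), which is PROVED in the tree
(`HrubesJoglekar2025_readK_perPoly_holds`, `….eventually_not_isReadK`).

The dictionary (`y = x + J`, so `x_e = y_e - 1`): substituting `x ↦ y - 1` in the representation
gives `per_n(y) = n! · det(1 + diag(y ∘ κ - 1) · K) = n! · det((1 - K) + diag(y ∘ κ) · K)`, and by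
the Schur complement (`Matrix.det_fromBlocks_one₂₂`)
`det((1 - K) + D K) = det [[1 - K, D], [-K, 1]]` with `D = diag(y_{κ(1)}, …, y_{κ(R)})`; bordering
with the `1 × 1` block `(n!)` gives a symbolic matrix (every entry a variable or a constant) of
size `1 + 2R` whose determinant is `per_n` and in which the variable `y_e` occurs exactly
`|κ⁻¹(e)| ≤ r` times — a read-`r` determinantal representation; for `r = 2` this is impossible
for `n ≥ n₀` by Hrubeš–Joglekar. No regularity, no heredity and no base-case computation are
needed, and the same argument gives every fixed `r` (`BoundedRankImpossible`).
-/

namespace Summit.ValiantsHypothesis.ValiantsHypothesis.Theorems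

-- justification: `Summit.<Summit>.<Problem>` repeats the name for single-problem summits (CONVENTIONS §1).
set_option linter.dupNamespace false

open Matrix MvPolynomial
open Literature.Computability.AlgebraicComplexity
open Summit.ValiantsHypothesis.ValiantsHypothesis.Theses.PrincipalMinorColouring

/-- **The dictionary.** A principal-minor representation
`per_n(x + J) = n! · det(I_R + diag(x ∘ κ) · K)` whose colour classes `κ⁻¹(e)` all have size `≤ r`
yields a read-`r` symbolic determinantal representation of `per_n` (Hrubeš–Joglekar's model:
entries are variables or constants), namely the block matrix `[[n!, 0, 0], [0, 1 - K, D], [0, -K, 1]]`,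
`D = diag(y_{κ(1)}, …, y_{κ(R)})`, of size `1 + 2R`, reindexed to `Fin (1 + (R + R))`. -/
theorem exists_isSymbDetRepr_isReadK_of_pmRepr {n R r : ℕ} (K : Matrix (Fin R) (Fin R) ℂ)
    (κ : Fin R → Fin n × Fin n)
    (hκ : ∀ e, (Finset.univ.filter (fun i => κ i = e)).card ≤ r)
    (h : MvPolynomial.aeval (fun e => MvPolynomial.X e + 1) (perPoly (Fin n) ℂ) =
      MvPolynomial.C (n.factorial : ℂ) *
        (1 + Matrix.diagonal (fun i => MvPolynomial.X (κ i)) *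
          K.map (fun a : ℂ => (MvPolynomial.C a : MvPolynomial (Fin n × Fin n) ℂ))).det) :
    ∃ (m : ℕ) (M : Matrix (Fin m) (Fin m) ((Fin n × Fin n) ⊕ ℂ)),
      IsSymbDetRepr (perPoly (Fin n) ℂ) M ∧ IsReadK M r := by
  classical
  -- Step 1: undo the shift (apply `x ↦ y - 1`):  `per_n = n! · det(1 + diag(X ∘ κ - 1) · K)`.
  set φ : MvPolynomial (Fin n × Fin n) ℂ →ₐ[ℂ] MvPolynomial (Fin n × Fin n) ℂ :=
    MvPolynomial.aeval (fun e => MvPolynomial.X e - 1) with hφ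
  have hcomp : ∀ p : MvPolynomial (Fin n × Fin n) ℂ,
      φ (MvPolynomial.aeval (fun e => MvPolynomial.X e + 1) p) = p := by
    intro p
    rw [MvPolynomial.comp_aeval_apply]
    have : (fun i => φ (MvPolynomial.X i + 1)) = MvPolynomial.X := by
      funext i
      simp [hφ]
    rw [this, MvPolynomial.aeval_X_left_apply]
  have hC : ∀ a : ℂ, φ (MvPolynomial.C a) = MvPolynomial.C a := fun a => by
    simp [hφ, MvPolynomial.algebraMap_eq]
  have hD : φ.mapMatrix (Matrix.diagonal fun i => MvPolynomial.X (κ i)) =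
      Matrix.diagonal fun i => MvPolynomial.X (κ i) - 1 := by
    rw [AlgHom.mapMatrix_apply, Matrix.diagonal_map (map_zero φ)]
    congr 1
    funext i
    simp [hφ]
  have hK : φ.mapMatrix (K.map fun a : ℂ => (MvPolynomial.C a : MvPolynomial (Fin n × Fin n) ℂ)) =
      K.map fun a : ℂ => (MvPolynomial.C a : MvPolynomial (Fin n × Fin n) ℂ) := by
    rw [AlgHom.mapMatrix_apply, Matrix.map_map]
    congr 1
    funext a
    exact hC a
  have h' : perPoly (Fin n) ℂ =
      MvPolynomial.C (n.factorial : ℂ) *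
        (1 + Matrix.diagonal (fun i => MvPolynomial.X (κ i) - 1) *
          K.map (fun a : ℂ => (MvPolynomial.C a : MvPolynomial (Fin n × Fin n) ℂ))).det := by
    have h2 := congrArg φ h
    rw [hcomp, map_mul, hC, AlgHom.map_det, map_add, map_one, map_mul, hD, hK] at h2
    exact h2
  -- Step 2: the symbolic block matrix `[[n!, 0, 0], [0, 1 - K, D], [0, -K, 1]]`.
  set M : Matrix (Fin 1 ⊕ (Fin R ⊕ Fin R)) (Fin 1 ⊕ (Fin R ⊕ Fin R)) ((Fin n × Fin n) ⊕ ℂ) :=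
    Matrix.fromBlocks (Matrix.of fun _ _ => Sum.inr (n.factorial : ℂ))
      (Matrix.of fun _ _ => Sum.inr 0) (Matrix.of fun _ _ => Sum.inr 0)
      (Matrix.fromBlocks
        (Matrix.of fun i j => Sum.inr ((1 : Matrix (Fin R) (Fin R) ℂ) i j - K i j))
        (Matrix.of fun i j => if i = j then Sum.inl (κ i) else Sum.inr 0)
        (Matrix.of fun i j => Sum.inr (-K i j))
        (Matrix.of fun i j => Sum.inr ((1 : Matrix (Fin R) (Fin R) ℂ) i j))) with hMdef
  -- its polynomial matrix
  have hsymb : symbPoly M =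
      Matrix.fromBlocks (Matrix.of fun _ _ => C (n.factorial : ℂ)) 0 0
        (Matrix.fromBlocks (1 - K.map C) (Matrix.diagonal fun i => X (κ i)) (-K.map C) 1) := by
    ext i j
    rcases i with i | i | i <;> rcases j with j | j | j <;>
      simp only [symbPoly, hMdef, Matrix.map_apply, Matrix.fromBlocks_apply₁₁,
        Matrix.fromBlocks_apply₁₂, Matrix.fromBlocks_apply₂₁, Matrix.fromBlocks_apply₂₂,
        Matrix.of_apply, Sum.elim_inr, Matrix.zero_apply, Matrix.sub_apply, Matrix.neg_apply,
        Matrix.one_apply, Matrix.diagonal_apply, map_zero, map_neg, map_sub] <;>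
      (split_ifs <;> simp)
  -- its determinant: `n! · det((1 - K) + D K) = per_n` (Schur complement)
  have hd : (Matrix.diagonal fun i => X (κ i) - 1 :
      Matrix (Fin R) (Fin R) (MvPolynomial (Fin n × Fin n) ℂ)) =
      Matrix.diagonal (fun i => X (κ i)) - 1 := by
    ext i j
    by_cases hij : i = j
    · subst hij; simp
    · simp [Matrix.diagonal_apply_ne _ hij, Matrix.one_apply_ne hij]
  have hM1 : (1 - K.map C - (Matrix.diagonal fun i => X (κ i)) * -K.map C :
      Matrix (Fin R) (Fin R) (MvPolynomial (Fin n × Fin n) ℂ)) =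
        1 + Matrix.diagonal (fun i => X (κ i) - 1) *
          K.map (fun a : ℂ => (C a : MvPolynomial (Fin n × Fin n) ℂ)) := by
    have hCf : (fun a : ℂ => (C a : MvPolynomial (Fin n × Fin n) ℂ)) = ⇑(C : ℂ →+* _) := rfl
    rw [hCf, hd, sub_mul, one_mul, Matrix.mul_neg, sub_neg_eq_add]
    abel
  have hdet : (symbPoly M).det = perPoly (Fin n) ℂ := by
    rw [hsymb, Matrix.det_fromBlocks_zero₂₁, Matrix.det_fromBlocks_one₂₂, Matrix.det_unique,
      Matrix.of_apply, hM1, ← h']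
  -- Step 3: reindex to `Fin (1 + (R + R))`; the variable `e` occurs only on the diagonal of `D`,
  -- at the positions `i` with `κ i = e`.
  let eR : Fin 1 ⊕ (Fin R ⊕ Fin R) ≃ Fin (1 + (R + R)) :=
    (Equiv.sumCongr (Equiv.refl (Fin 1)) finSumFinEquiv).trans finSumFinEquiv
  have hocc : ∀ e, occurrences (Matrix.reindex eR eR M) e ≤
      (Finset.univ.filter (fun i => κ i = e)).card := by
    intro e
    unfold occurrences
    rw [Nat.card_eq_fintype_card, Fintype.card_subtype]
    let g : Fin R → Fin (1 + (R + R)) × Fin (1 + (R + R)) :=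
      fun i => (eR (Sum.inr (Sum.inl i)), eR (Sum.inr (Sum.inr i)))
    have hsub : (Finset.univ.filter fun ij : Fin (1 + (R + R)) × Fin (1 + (R + R)) =>
          (Matrix.reindex eR eR M) ij.1 ij.2 = Sum.inl e) ⊆
        (Finset.univ.filter (fun i => κ i = e)).image g := by
      intro ij hij
      simp only [Finset.mem_filter, Finset.mem_univ, true_and, Matrix.reindex_apply,
        Matrix.submatrix_apply] at hij
      simp only [Finset.mem_image, Finset.mem_filter, Finset.mem_univ, true_and]
      have h1 : eR (eR.symm ij.1) = ij.1 := Equiv.apply_symm_apply _ _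
      have h2 : eR (eR.symm ij.2) = ij.2 := Equiv.apply_symm_apply _ _
      generalize eR.symm ij.1 = a at hij h1
      generalize eR.symm ij.2 = b at hij h2
      rcases a with a | a | a <;> rcases b with b | b | b <;>
        simp only [hMdef, Matrix.fromBlocks_apply₁₁, Matrix.fromBlocks_apply₁₂,
          Matrix.fromBlocks_apply₂₁, Matrix.fromBlocks_apply₂₂, Matrix.of_apply,
          reduceCtorEq] at hij
      split_ifs at hij with hab
      subst hab
      simp only [Sum.inl.injEq] at hij
      exact ⟨a, hij, Prod.ext h1 h2⟩
    calc (Finset.univ.filter fun ij : Fin (1 + (R + R)) × Fin (1 + (R + R)) =>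
            (Matrix.reindex eR eR M) ij.1 ij.2 = Sum.inl e).card
        ≤ ((Finset.univ.filter (fun i => κ i = e)).image g).card := Finset.card_le_card hsub
      _ ≤ (Finset.univ.filter (fun i => κ i = e)).card := Finset.card_image_le
  -- Step 4: assemble.
  refine ⟨1 + (R + R), Matrix.reindex eR eR M, ?_, fun e => (hocc e).trans (hκ e)⟩
  unfold IsSymbDetRepr
  have hmap : symbPoly (Matrix.reindex eR eR M) = Matrix.reindex eR eR (symbPoly M) := by
    unfold symbPoly
    ext i j
    simp [Matrix.reindex_apply, Matrix.submatrix_apply, Matrix.map_apply]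
  rw [hmap, Matrix.det_reindex_self, hdet]

/-- **`BoundedRankImpossible`** (route PrincipalMinorColouring, crux stmt-ValiantsHypothesis-3777),
proved on the way: for every `r` there is `n₀` such that for all `n ≥ n₀`, `R`, `K ∈ ℂ^{R × R}` and
colourings `κ : [R] → [n]²` with all classes `κ⁻¹(e)` of size `≤ r`,
`per_n(x + J) ≠ n! · det(I_R + diag(x ∘ κ) · K)` — i.e. for each fixed `r`, `per_n` has no rank-`r`
(equivalently read-`r`) determinantal expression of any size once `n` is large. From the dictionary
`exists_isSymbDetRepr_isReadK_of_pmRepr` and Hrubeš–Joglekar 2025, Cor. 8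
(`HrubesJoglekar2025_readK_perPoly_holds`, proved in the tree). -/
theorem boundedRankImpossible_proof : BoundedRankImpossible := by
  intro r
  have hk : ringChar ℂ ≠ 2 := by
    rw [ringChar.eq_zero]; norm_num
  obtain ⟨n₀, hn₀⟩ :=
    HrubesJoglekar2025_readK_perPoly.eventually_not_isReadK HrubesJoglekar2025_readK_perPoly_holds
      ℂ hk r
  refine ⟨n₀, fun n hn R K κ hκ heq => ?_⟩
  obtain ⟨m, M, hM, hR⟩ := exists_isSymbDetRepr_isReadK_of_pmRepr K κ hκ heq
  exact hn₀ n hn m M hM hR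

/-- **`RankTwoImpossible`** (route PrincipalMinorColouring, item stmt-ValiantsHypothesis-3782):
there is `n₀` such that for all `n ≥ n₀`, `R`, `K ∈ ℂ^{R × R}` and colourings `κ : [R] → [n]²` with
all classes `κ⁻¹(e)` of size `≤ 2`, `per_n(x + J) ≠ n! · det(I_R + diag(x ∘ κ) · K)` — i.e. `per_n` has
no rank-`2` (equivalently read-twice) determinantal expression of any size for large `n`
(the `k = 2` question of Aravind–Joglekar 2015, §5). The `r = 2` instance of
`boundedRankImpossible_proof` (glue `rankTwoImpossible_of_boundedRankImpossible`). -/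
theorem rankTwoImpossible_proof : RankTwoImpossible :=
  rankTwoImpossible_of_boundedRankImpossible boundedRankImpossible_proof

end Summit.ValiantsHypothesis.ValiantsHypothesis.Theorems
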